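import Literature.AlgebraicGeometry.ModuliOfAbelianVarieties.SiegelFamilyIsogenyInducedPolarisation
import Literature.AlgebraicGeometry.ModuliOfAbelianVarieties.SiegelFamilyHumbertRealMultiplication
import Mathlib.NumberTheory.Pell
import HarnessLib

/-!
# Orr's obstruction (§4.3): on a real-multiplication Humbert surface the units of the order give NON-POLARISED
# automorphisms `h = ρ(u)` of the principally polarised `X_Z`, with `q_h = h'h = h² = ρ(u²)` of UNBOUNDED trace

Layer `Literature/AlgebraicGeometry/ModuliOfAbelianVarieties`, namespace
`Literature.AlgebraicGeometry.ModuliOfAbelianVarieties.SiegelModuli`; lane `lit-hodgefound` (Track 2, Layer A4), seat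
`lit-hodgefound-skel-4`, row A4-149 of `run/shared/lean/pub/lit-hodgefound/SKELETON.md` — the junction of rows A4-147
(`SiegelFamilyIsogenyInducedPolarisation`: Orr's `q = A'A`, «polarised ⟺ `q` scalar»; imported), A4-148
(`SiegelFamilyHomRosatiNorm`: the trace norm `Tr(A'A) > 0`; sibling, not imported — the norm is `Matrix.trace`) and A4-64 FILE 2 (`SiegelFamilyHumbertRealMultiplication`: the order `O = ℤ[ω]`,
`ω² = k + lω`, of discriminant `Δ = l² + 4k` acts on `X_Z`, `Z ∈ H_{(k,l,−1,0,0)} ⊂ 𝔥₂`, through the symmetric integer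
matrices `ρ(x) = rmRatRep k l x`), with Mathlib's Pell equation (`Pell.Solution₁`, `Pell.IsFundamental`).
THEOREMS ONLY (D-0026, net debt 0; no `def`, no instance, no notation).

## Source, verbatim (`paper:arxiv-1209.3653`, p0012 L66–L76 = Orr 2015 §4.3)

«let `h : A → A'` be an isogeny of degree `n`.  Then `h^*λ'` is a polarisation of `A`, so there is a symmetric positive
definite endomorphism `q ∈ End A` such that `h^*λ' = λ ∘ q`. […] So we would like to bound the height of the rational
representation of `q` in terms of `deg h`.  However this is not possible: let `A` be an abelian variety whose
endomorphism ring is the ring of integers `𝔬` of a real quadratic field.  In particular `𝔬` has infinitely many units.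
Let `h` be a unit in `𝔬` – in other words, an isomorphism `A → A`.  If we take the same polarisation on each copy of
`A`, then `q = h²` and the rational representation of this can have arbitrarily large height.  We can avoid this by
replacing `h` by `h ∘ u` for some automorphism `u` of `A`».  (The «height» of §4.2 is the maximum of the absolute values
of the entries of the integer matrix; we measure `q` by its trace `Tr(q) = Tr(h'h)`, the Rosati norm of A4-148, which
bounds the height from below by `Tr(q)/4`.)  Background: B. Runge, Tohoku Math. J. 51 (1999) §4 pp. 290–291 and
Ch. Birkenhake–H. Wilhelm, Trans. AMS 355 (2003) §4 (the order `O_Δ ⊆ End^s(X_Z)` on `H_Δ`, row A4-64).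

## What is proved (`O = QuadraticAlgebra ℤ k l`, `ρ = rmRatRep k l : O →+* M₄(ℤ)`, `Δ = quadDisc k l = l² + 4k`,
## `Z ∈ H_{(k,l,−1,0,0)}` = `humbertLocus (humbertNormalForm k l)`)

* §1 `ρ(x)' = ρ(x)` for the transpose `rosati J` of rows A4-145/147 (`rosati_J_rmRatRep`), **Orr's `q = h²`:
  `ρ(x)'ρ(x) = ρ(x²)`** (`rosati_J_rmRatRep_mul_self`), `det ρ(x) = N(x)²`, `Tr ρ(x) = 2 Tr_{O/ℤ}(x) = 2(2a + lb)`.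
* §2 on the Humbert surface: `ρ(x)` is a homomorphism `X_Z → X_Z` (`exists_analyticRep_rmRatRep`), an isogeny of
  degree `N(x)²` when `N(x) ≠ 0` (`isIsogeny_rmRatRep`, `natCard_ker_rmRatRep`), **an AUTOMORPHISM (degree `1`) for a
  unit** (`natCard_ker_rmRatRep_eq_one_of_isUnit`); `φ_Z(ρ(x)^*E_Z) = ρ(x²)`; **`ρ(x)` IS POLARISED WITH MULTIPLIER `n`
  IFF `x² = n` IN `O`** (`compContinuousLinearMap_realRep_rmRatRep_eq_smul_iff`).
* §3 **FOR `Δ > 0` NOT A SQUARE, A UNIT `u ≠ ±1` HAS `u² ∉ ℤ`** (`mul_self_ne_intCast_of_isUnit`), so **`ρ(u)` is a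
  NON-POLARISED AUTOMORPHISM of the principally polarised `X_Z`** (`not_polarised_rmRatRep_of_isUnit`).
* §4 PELL: the unit `u_a = (x − ly) + 2yω` of norm `x² − Δy² = 1` attached to a solution `a = (x, y)` of Pell's equation
  for `Δ` (`norm_pellUnit_eq_one`), `u_a ≠ ±1` iff `y ≠ 0`, and **`Tr(q_{ρ(u_a)}) = Tr ρ(u_a²) = 4 + 8Δy²`**
  (`trace_rosati_J_rmRatRep_pellUnit_mul_self`); hence, via the fundamental solution and `y(a₁ⁿ) ↑ ∞`
  (`Pell.IsFundamental.y_strictMono`): **for every bound `B` there is an automorphism `h` of `X_Z` (an isogeny of degree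
  `1`, symmetric) with `Tr(h'h) > B`** (`exists_automorphism_trace_rosati_J_mul_self_gt` — «`q = h²` … can have
  arbitrarily large height»), and a non-polarised automorphism exists (`exists_automorphism_not_polarised`).

## References

* [Orr2013] M. Orr, *Families of abelian varieties with many isogenous fibres*, J. reine angew. Math. 705 (2015), §4.2–§4.3 (p0012).
* [Runge1999EndomorphismRingsAbelianSurfaces] B. Runge, Tohoku Math. J. 51 (1999), §4 pp. 290–291.
* [BirkenhakeWilhelm2003] Ch. Birkenhake, H. Wilhelm, Trans. AMS 355 (2003), §4 Lemma 4.1, Cor. 4.2, Cor. 4.4, Prop. 4.9 (2).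
* [Lange2023AbelianVarietiesComplex] H. Lange, Springer (2023), §5.1.1 Thm. 5.1.8 (p0255), §2.4.2 Lemma 2.4.15 (p0119).
-/

noncomputable section

open Matrix Module Function Set
open scoped Matrix

namespace Literature.AlgebraicGeometry.ModuliOfAbelianVarieties

namespace SiegelModuli

open Literature.NumberTheory.Automorphic (siegelUpperHalfSpace)
open Literature.NumberTheory.ModularForms Literature.NumberTheory.ModularForms.SiegelUpperHalfSpace
open Literature.NumberTheory.ComplexMultiplication
open Literature.Geometry.Kaehler Literature.Geometry.Kaehler.ComplexTorus

variable {k l : ℤ}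

/-! ## §1 `ρ(x)' = ρ(x)`, `q = ρ(x)'ρ(x) = ρ(x²)`, `det ρ(x) = N(x)²`, `Tr ρ(x) = 2 Tr(x)` -/

section Algebra

/-- **`ρ(x)' = ρ(x)` for the transpose `J⁻¹ᵗ(·)J`**: real multiplication is SYMMETRIC (B–W Lemma 4.1 `f₀' = f₀`; the
tree's `rosati_rmRatRep` for `rosati E₁`, and `rosati E₁ = rosati J`, A4-147). [cite: BirkenhakeWilhelm2003, §4 Lemma 4.1 (p. 1827) and Cor. 4.4 (p. 1828)] -/
theorem rosati_J_rmRatRep (x : QuadraticAlgebra ℤ k l) :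
    rosati (Matrix.J (Fin 2) ℤ) (rmRatRep k l x) = rmRatRep k l x := by
  rw [← rosati_typeForm_one_eq_rosati_J, rosati_rmRatRep]

/-- **ORR'S `q = h²`: `ρ(x)'ρ(x) = ρ(x)ρ(x) = ρ(x²)`** — for a symmetric `h = ρ(x)` the symmetric endomorphism `q = h'h`
of §4.3 is `h²`. [cite: Orr2013, §4.3 (p0012 L72–L73: «then `q = h²`»)] -/
theorem rosati_J_rmRatRep_mul_self (x : QuadraticAlgebra ℤ k l) :
    rosati (Matrix.J (Fin 2) ℤ) (rmRatRep k l x) * rmRatRep k l x = rmRatRep k l (x * x) := by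
  rw [rosati_J_rmRatRep, rmRatRep_mul]

/-- **`det ρ(x) = N(x)²`** (`ρ = diag(ᵗA(x), A(x))`, `det A(x) = N(x)`). [cite: Runge1999EndomorphismRingsAbelianSurfaces, §4 p. 290] -/
theorem det_rmRatRep (x : QuadraticAlgebra ℤ k l) : (rmRatRep k l x).det = QuadraticAlgebra.norm x ^ 2 := by
  rw [rmRatRep_apply, Matrix.det_fromBlocks_zero₂₁, Matrix.det_transpose, det_regRep, sq]

/-- **`Tr ρ(x) = 2 Tr_{O/ℤ}(x) = 2(2a + lb)`** for `x = a + bω`. [cite: Runge1999EndomorphismRingsAbelianSurfaces, §4 p. 290] [cite: BirkenhakeWilhelm2003, §4 Prop. 4.3 (p. 1828: `Tr_a(n + mf₀) = 2n + mb`)] -/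
theorem trace_rmRatRep (x : QuadraticAlgebra ℤ k l) : (rmRatRep k l x).trace = 2 * (2 * x.re + l * x.im) := by
  have h := trace_regRep k l x
  rw [Matrix.trace, Fin.sum_univ_two] at h
  rw [rmRatRep_apply, Matrix.trace, Fintype.sum_sum_type, Fin.sum_univ_two, Fin.sum_univ_two]
  simp only [Matrix.diag_apply, Matrix.fromBlocks_apply₁₁, Matrix.fromBlocks_apply₂₂, Matrix.transpose_apply] at h ⊢
  linarith [h]

/-- `ρ(n) = n·1` for `n ∈ ℤ`. [cite: Runge1999EndomorphismRingsAbelianSurfaces, §4 p. 290] -/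
theorem rmRatRep_intCast (n : ℤ) :
    rmRatRep k l (n : QuadraticAlgebra ℤ k l) = n • (1 : Matrix (Fin 2 ⊕ Fin 2) (Fin 2 ⊕ Fin 2) ℤ) := by
  rw [← rmRatRepHom_apply, map_intCast, zsmul_one]

end Algebra

/-! ## §2 On the Humbert surface: `ρ(x)` is a homomorphism, an isogeny of degree `N(x)²`, polarised iff `x² ∈ ℤ` -/

section Humbert

variable {Z : siegelUpperHalfSpace 2}

/-- **`ρ(x) : X_Z → X_Z` is a homomorphism of complex tori for `Z ∈ H_{(k,l,−1,0,0)}`** (its analytic representation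
is the tree's `intAnalyticRep`; row A4-64 `rmRatRep_mem_endRingInt`). [cite: Runge1999EndomorphismRingsAbelianSurfaces, §4 pp. 290–291 («`O ⊂ End(A_{π[R]}) ⊂ M₄(ℤ)`»)] -/
theorem exists_analyticRep_rmRatRep (hZ : Z ∈ humbertLocus (fun i ↦ (humbertNormalForm k l i : ℂ)))
    (x : QuadraticAlgebra ℤ k l) :
    ∃ f : (Fin 2 → ℂ) →L[ℂ] (Fin 2 → ℂ),
      ∀ y, prinPeriod Z (((rmRatRep k l x).map (Int.cast : ℤ → ℝ)) *ᵥ y) = f (prinPeriod Z y) :=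
  ⟨intAnalyticRep (prinPeriod Z : (Fin 2 ⊕ Fin 2 → ℝ) ≃L[ℝ] (Fin 2 → ℂ)) _ (rmRatRep_mem_endRingInt hZ x),
    fun y ↦ (intAnalyticRep_apply _ (rmRatRep_mem_endRingInt hZ x) y).symm⟩

/-- **`ρ(x)` is an isogeny `X_Z → X_Z` when `N(x) ≠ 0`** (`det ρ(x) = N(x)² ≠ 0`). [cite: Runge1999EndomorphismRingsAbelianSurfaces, §4 pp. 290–291] [cite: Lange2023AbelianVarietiesComplex, §1.1.2 Lemma 1.1.11 (p0021)] -/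
theorem isIsogeny_rmRatRep (hZ : Z ∈ humbertLocus (fun i ↦ (humbertNormalForm k l i : ℂ)))
    {x : QuadraticAlgebra ℤ k l} (hx : QuadraticAlgebra.norm x ≠ 0) :
    IsIsogeny (prinPeriod Z) (prinPeriod Z) (rmRatRep k l x) := by
  rw [isIsogeny_iff_det_ne_zero]
  exact ⟨exists_analyticRep_rmRatRep hZ x, by rw [det_rmRatRep]; exact pow_ne_zero _ hx⟩

/-- **`deg ρ(x) = N(x)²`** (`#ker = |det|`). [cite: Lange2023AbelianVarietiesComplex, §1.1.2 Prop. 1.1.13 (p0022)] [cite: Runge1999EndomorphismRingsAbelianSurfaces, §4 p. 290] -/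
theorem natCard_ker_rmRatRep (Z : siegelUpperHalfSpace 2) (x : QuadraticAlgebra ℤ k l) :
    Nat.card (mapMatrixHom (prinPeriod Z) (prinPeriod Z) (rmRatRep k l x)).ker = (QuadraticAlgebra.norm x).natAbs ^ 2 := by
  rw [natCard_ker_mapMatrixHom, det_rmRatRep, Int.natAbs_pow]

/-- **A UNIT `u ∈ O^×` ACTS AS AN AUTOMORPHISM: `deg ρ(u) = 1`** («let `h` be a unit in `𝔬` – in other words, an
isomorphism `A → A`»). [cite: Orr2013, §4.3 (p0012 L71–L72)] -/
theorem natCard_ker_rmRatRep_eq_one_of_isUnit (Z : siegelUpperHalfSpace 2) {u : QuadraticAlgebra ℤ k l}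
    (hu : IsUnit u) : Nat.card (mapMatrixHom (prinPeriod Z) (prinPeriod Z) (rmRatRep k l u)).ker = 1 := by
  rw [natCard_ker_rmRatRep, Int.isUnit_iff_natAbs_eq.1 (QuadraticAlgebra.isUnit_iff_norm_isUnit.1 hu), one_pow]

/-- A unit acts as an isogeny (of degree `1`). [cite: Orr2013, §4.3 (p0012 L71–L72)] -/
theorem isIsogeny_rmRatRep_of_isUnit (hZ : Z ∈ humbertLocus (fun i ↦ (humbertNormalForm k l i : ℂ)))
    {u : QuadraticAlgebra ℤ k l} (hu : IsUnit u) : IsIsogeny (prinPeriod Z) (prinPeriod Z) (rmRatRep k l u) :=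
  isIsogeny_rmRatRep hZ (QuadraticAlgebra.isUnit_iff_norm_isUnit.1 hu).ne_zero

/-- **`φ_Z(ρ(x)^*E_Z) = ρ(x²)`**: Orr's `q` of the homomorphism `ρ(x)` with the same principal polarisation `E_Z` on both
copies is `ρ(x)'ρ(x) = ρ(x²)` (A4-147 `nsToEndInt_eq_rosati_J_mul_self_of_coe_eq`). [cite: Orr2013, §4.3 (p0012 L66–L73)] [cite: Lange2023AbelianVarietiesComplex, §2.4.2 Lemma 2.4.15 (p0119)] -/
theorem nsToEndInt_eq_rmRatRep_mul_self (hZ : Z ∈ humbertLocus (fun i ↦ (humbertNormalForm k l i : ℂ)))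
    (x : QuadraticAlgebra ℤ k l) {η' : neronSeveriGroup (prinPeriod Z)}
    (h : (η' : (Fin 2 → ℂ) [⋀^Fin 2]→L[ℝ] ℝ) =
      (prinForm Z).compContinuousLinearMap (realRep (prinPeriod Z) (prinPeriod Z) (rmRatRep k l x))) :
    nsToEndInt (prinPeriod Z) (typeForm fun _ : Fin 2 ↦ 1) η' = rmRatRep k l (x * x) := by
  rw [nsToEndInt_eq_rosati_J_mul_self_of_coe_eq Z Z (exists_analyticRep_rmRatRep hZ x) h, rosati_J_rmRatRep_mul_self]

/-- **`ρ(x)` IS POLARISED WITH MULTIPLIER `n` IFF `x² = n` IN `O`**: `ρ(x)^*E_Z = n·E_Z ⟺ ρ(x)'ρ(x) = n·1 ⟺ ρ(x²) = ρ(n)`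
(A4-147's «polarised ⟺ `q` scalar» and injectivity of `ρ`). [cite: Orr2013, §4.2 (p0012 L57–L62) and §4.3 (p0012 L66–L73)] -/
theorem compContinuousLinearMap_realRep_rmRatRep_eq_smul_iff (Z : siegelUpperHalfSpace 2) (x : QuadraticAlgebra ℤ k l)
    (n : ℤ) :
    (prinForm Z).compContinuousLinearMap (realRep (prinPeriod Z) (prinPeriod Z) (rmRatRep k l x)) = (n : ℝ) • prinForm Z ↔
      x * x = n := by
  rw [compContinuousLinearMap_realRep_eq_smul_iff_rosati_J_mul_self_eq, rosati_J_rmRatRep_mul_self, ← rmRatRep_intCast,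
    (rmRatRep_injective k l).eq_iff]

end Humbert

/-! ## §3 Units `u ≠ ±1` of a real quadratic order have `u² ∉ ℤ`: `ρ(u)` is a non-polarised automorphism -/

section Units

/-- **FOR `Δ = l² + 4k > 0` NOT A SQUARE, A UNIT `u ≠ ±1` OF `O` HAS `u² ≠ n` FOR EVERY `n ∈ ℤ`** (`u = a + bω`:
`Im(u²) = b(2a + lb)`; `b = 0` forces `u = ±1`, and `2a = −lb` forces `b²Δ = −4N(u) = ∓4`, i.e. `Δ ∈ {1, 4}`).
[cite: Orr2013, §4.3 (p0012 L70–L73)] -/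
theorem mul_self_ne_intCast_of_isUnit (hΔ0 : 0 < quadDisc k l) (hΔ : ¬IsSquare (quadDisc k l))
    {u : QuadraticAlgebra ℤ k l} (hu : IsUnit u) (h1 : u ≠ 1) (h1' : u ≠ -1) (n : ℤ) :
    u * u ≠ (n : QuadraticAlgebra ℤ k l) := by
  intro h
  have hN := QuadraticAlgebra.isUnit_iff_norm_isUnit.1 hu
  rw [QuadraticAlgebra.norm_def] at hN
  have him := congrArg QuadraticAlgebra.im h
  rw [QuadraticAlgebra.im_mul, QuadraticAlgebra.im_intCast] at him
  -- `him : a b + b a + l b b = 0`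
  have hfac : u.im * (2 * u.re + l * u.im) = 0 := by linear_combination him
  rcases mul_eq_zero.1 hfac with hb | h2a
  · -- `b = 0`: `u = a`, `a² = ±1`, so `u = ±1`
    rw [hb, mul_zero, mul_zero, sub_zero, add_zero] at hN
    rcases Int.isUnit_iff.1 (isUnit_of_mul_isUnit_left hN) with ha | ha
    · exact h1 (QuadraticAlgebra.ext (by rw [QuadraticAlgebra.re_one]; exact ha)
        (by rw [QuadraticAlgebra.im_one]; exact hb))
    · exact h1' (QuadraticAlgebra.ext (by rw [QuadraticAlgebra.re_neg, QuadraticAlgebra.re_one]; exact ha)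
        (by rw [QuadraticAlgebra.im_neg, QuadraticAlgebra.im_one, neg_zero]; exact hb))
  · -- `2a = -lb`, `b ≠ 0` would make `Δ` a square
    have hb : u.im ≠ 0 := by
      intro hb
      rw [hb, mul_zero, add_zero] at h2a
      have ha : u.re = 0 := by linarith
      rw [ha, hb] at hN
      simp at hN
    have hkey : u.im ^ 2 * quadDisc k l = -4 * (u.re * u.re + l * u.re * u.im - k * u.im * u.im) := by
      rw [quadDisc_apply]; linear_combination (2 * u.re + l * u.im) * h2a
    rcases Int.isUnit_iff.1 hN with hN1 | hN1 <;> rw [hN1] at hkey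
    · nlinarith [sq_nonneg u.im]
    · have hb2 : u.im ^ 2 * quadDisc k l = 4 := by linarith
      have hle : u.im ^ 2 ≤ 4 := by nlinarith
      have hb' : -2 ≤ u.im ∧ u.im ≤ 2 := by constructor <;> nlinarith [sq_nonneg (u.im + 2), sq_nonneg (u.im - 2)]
      obtain ⟨hlo, hhi⟩ := hb'
      have him2 : u.im = -2 ∨ u.im = -1 ∨ u.im = 1 ∨ u.im = 2 := by omega
      rcases him2 with h | h | h | h <;> rw [h] at hb2
      · exact hΔ ⟨1, by linarith⟩
      · exact hΔ ⟨2, by linarith⟩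
      · exact hΔ ⟨2, by linarith⟩
      · exact hΔ ⟨1, by linarith⟩

variable {Z : siegelUpperHalfSpace 2}

/-- **ORR'S OBSTRUCTION: A UNIT `u ≠ ±1` GIVES A NON-POLARISED AUTOMORPHISM `ρ(u)` OF THE PRINCIPALLY POLARISED `X_Z`**
(`Z` on the real-multiplication Humbert surface `H_{(k,l,−1,0,0)}`, `Δ > 0` not a square): `ρ(u)^*E_Z ≠ n·E_Z` for all
`n ∈ ℤ` — its `q = ρ(u²)` is not a scalar («if we take the same polarisation on each copy of `A`, then `q = h²`»).
[cite: Orr2013, §4.3 (p0012 L70–L74)] -/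
theorem not_polarised_rmRatRep_of_isUnit (hΔ0 : 0 < quadDisc k l) (hΔ : ¬IsSquare (quadDisc k l))
    {u : QuadraticAlgebra ℤ k l} (hu : IsUnit u) (h1 : u ≠ 1) (h1' : u ≠ -1) (n : ℤ) :
    (prinForm Z).compContinuousLinearMap (realRep (prinPeriod Z) (prinPeriod Z) (rmRatRep k l u)) ≠ (n : ℝ) • prinForm Z :=
  fun h ↦ mul_self_ne_intCast_of_isUnit hΔ0 hΔ hu h1 h1' n
    ((compContinuousLinearMap_realRep_rmRatRep_eq_smul_iff Z u n).1 h)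

end Units

/-! ## §4 Pell units: `Tr(q) = 4 + 8Δy²` is unbounded over the automorphisms of `X_Z` -/

section PellUnits

/-- **The unit `u_a = (x − ly) + 2yω ∈ O` of a solution `a = (x, y)` of Pell's equation `x² − Δy² = 1` has norm
`N(u_a) = x² − Δy² = 1`** (`√Δ = 2ω − l`). [cite: Orr2013, §4.3 (p0012 L71: «`𝔬` has infinitely many units»)] [cite: BirkenhakeWilhelm2003, §4 Prop. 4.3 and Prop. 4.9 (2) (pp. 1828, 1831)] -/
theorem norm_pellUnit_eq_one (a : Pell.Solution₁ (quadDisc k l)) :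
    QuadraticAlgebra.norm (⟨a.x - l * a.y, 2 * a.y⟩ : QuadraticAlgebra ℤ k l) = 1 := by
  have hp : a.x ^ 2 - (l ^ 2 + 4 * k) * a.y ^ 2 = 1 := a.prop
  rw [QuadraticAlgebra.norm_def]
  dsimp only
  linear_combination hp

/-- `u_a` is a unit of `O`. [cite: Orr2013, §4.3 (p0012 L71)] -/
theorem isUnit_pellUnit (a : Pell.Solution₁ (quadDisc k l)) :
    IsUnit (⟨a.x - l * a.y, 2 * a.y⟩ : QuadraticAlgebra ℤ k l) :=
  QuadraticAlgebra.isUnit_iff_norm_isUnit.2 (by rw [norm_pellUnit_eq_one]; exact isUnit_one)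

/-- `u_a ≠ 1` as soon as `y ≠ 0`. [cite: Orr2013, §4.3 (p0012 L71)] -/
theorem pellUnit_ne_one {a : Pell.Solution₁ (quadDisc k l)} (hy : a.y ≠ 0) :
    (⟨a.x - l * a.y, 2 * a.y⟩ : QuadraticAlgebra ℤ k l) ≠ 1 := fun h ↦
  hy (by have := congrArg QuadraticAlgebra.im h; rw [QuadraticAlgebra.im_one] at this; simpa using this)

/-- `u_a ≠ -1` as soon as `y ≠ 0`. [cite: Orr2013, §4.3 (p0012 L71)] -/
theorem pellUnit_ne_neg_one {a : Pell.Solution₁ (quadDisc k l)} (hy : a.y ≠ 0) :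
    (⟨a.x - l * a.y, 2 * a.y⟩ : QuadraticAlgebra ℤ k l) ≠ -1 := fun h ↦
  hy (by
    have := congrArg QuadraticAlgebra.im h
    rw [QuadraticAlgebra.im_neg, QuadraticAlgebra.im_one, neg_zero] at this
    simpa using this)

/-- **`Tr(q) = Tr ρ(u_a²) = 4 + 8Δy²` FOR THE AUTOMORPHISM `h = ρ(u_a)`** — the Rosati norm of `h` grows with the Pell
solution («`q = h²` and the rational representation of this can have arbitrarily large height»).
[cite: Orr2013, §4.3 (p0012 L72–L74)] -/
theorem trace_rosati_J_rmRatRep_pellUnit_mul_self (a : Pell.Solution₁ (quadDisc k l)) :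
    (rosati (Matrix.J (Fin 2) ℤ) (rmRatRep k l (⟨a.x - l * a.y, 2 * a.y⟩ : QuadraticAlgebra ℤ k l)) *
        rmRatRep k l (⟨a.x - l * a.y, 2 * a.y⟩ : QuadraticAlgebra ℤ k l)).trace =
      4 + 8 * quadDisc k l * a.y ^ 2 := by
  have hp : a.x ^ 2 - (l ^ 2 + 4 * k) * a.y ^ 2 = 1 := a.prop
  rw [rosati_J_rmRatRep_mul_self, trace_rmRatRep, QuadraticAlgebra.re_mul, QuadraticAlgebra.im_mul]
  show _ = 4 + 8 * (l ^ 2 + 4 * k) * a.y ^ 2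
  dsimp only
  linear_combination (4 : ℤ) * hp

/-- `y(a₁ⁿ) ≥ n` for the fundamental solution (`y` is strictly increasing along the powers, `y(a₁⁰) = 0`).
[cite: Orr2013, §4.3 (p0012 L71: «infinitely many units»)] -/
theorem le_y_zpow_of_isFundamental {d : ℤ} {a₁ : Pell.Solution₁ d} (h : Pell.IsFundamental a₁) (n : ℕ) :
    (n : ℤ) ≤ (a₁ ^ (n : ℤ)).y := by
  induction n with
  | zero => simp
  | succ n ih =>
    have hlt := h.y_strictMono (show (n : ℤ) < (n : ℤ) + 1 by omega)
    simp only at hlt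
    push_cast
    omega

variable {Z : siegelUpperHalfSpace 2}

/-- **«`q = h²` … CAN HAVE ARBITRARILY LARGE HEIGHT»: for `Z` on the real-multiplication Humbert surface
`H_{(k,l,−1,0,0)}` with `Δ = l² + 4k > 0` not a square, the Rosati norm `Tr(h'h)` is UNBOUNDED on the automorphisms
`h` of the principally polarised `X_Z`** — for every `B` there is a symmetric automorphism `h = ρ(u)` (an isogeny
`X_Z → X_Z` of degree `1`, `u` a Pell unit) with `Tr(h'h) > B`. [cite: Orr2013, §4.3 (p0012 L70–L74)] -/
theorem exists_automorphism_trace_rosati_J_mul_self_gt (hΔ0 : 0 < quadDisc k l) (hΔ : ¬IsSquare (quadDisc k l))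
    (hZ : Z ∈ humbertLocus (fun i ↦ (humbertNormalForm k l i : ℂ))) (B : ℤ) :
    ∃ A : Matrix (Fin 2 ⊕ Fin 2) (Fin 2 ⊕ Fin 2) ℤ, IsIsogeny (prinPeriod Z) (prinPeriod Z) A ∧
      Nat.card (mapMatrixHom (prinPeriod Z) (prinPeriod Z) A).ker = 1 ∧
        A ∈ symmEndInt (prinPeriod Z : (Fin 2 ⊕ Fin 2 → ℝ) ≃L[ℝ] (Fin 2 → ℂ)) (typeForm fun _ : Fin 2 ↦ 1) ∧
          B < (rosati (Matrix.J (Fin 2) ℤ) A * A).trace := by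
  obtain ⟨a₁, ha₁⟩ := Pell.IsFundamental.exists_of_not_isSquare hΔ0 hΔ
  set a : Pell.Solution₁ (quadDisc k l) := a₁ ^ ((B.natAbs + 1 : ℕ) : ℤ) with ha
  have hy : ((B.natAbs + 1 : ℕ) : ℤ) ≤ a.y := le_y_zpow_of_isFundamental ha₁ _
  set u : QuadraticAlgebra ℤ k l := ⟨a.x - l * a.y, 2 * a.y⟩ with hu
  refine ⟨rmRatRep k l u, isIsogeny_rmRatRep_of_isUnit hZ (isUnit_pellUnit a),
    natCard_ker_rmRatRep_eq_one_of_isUnit Z (isUnit_pellUnit a), rmRatRep_mem_symmEndInt hZ u, ?_⟩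
  rw [hu, trace_rosati_J_rmRatRep_pellUnit_mul_self]
  have hB : B < a.y := by omega
  have hy1 : 1 ≤ a.y := by omega
  nlinarith

/-- **A NON-POLARISED AUTOMORPHISM EXISTS on every `X_Z`, `Z ∈ H_{(k,l,−1,0,0)}`, `Δ > 0` not a square**: an isogeny
`h : X_Z → X_Z` of degree `1` whose `q = h'h` is not a scalar, `h^*E_Z ≠ n·E_Z` for all `n` (Orr's reason for
replacing `h` by `h ∘ u`). [cite: Orr2013, §4.3 (p0012 L70–L76)] -/
theorem exists_automorphism_not_polarised (hΔ0 : 0 < quadDisc k l) (hΔ : ¬IsSquare (quadDisc k l))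
    (hZ : Z ∈ humbertLocus (fun i ↦ (humbertNormalForm k l i : ℂ))) :
    ∃ A : Matrix (Fin 2 ⊕ Fin 2) (Fin 2 ⊕ Fin 2) ℤ, IsIsogeny (prinPeriod Z) (prinPeriod Z) A ∧
      Nat.card (mapMatrixHom (prinPeriod Z) (prinPeriod Z) A).ker = 1 ∧
        ∀ n : ℤ, (prinForm Z).compContinuousLinearMap (realRep (prinPeriod Z) (prinPeriod Z) A) ≠ (n : ℝ) • prinForm Z := by
  obtain ⟨a, ha⟩ := Pell.Solution₁.exists_pos_of_not_isSquare hΔ0 hΔ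
  have hy : a.y ≠ 0 := ha.2.ne'
  exact ⟨rmRatRep k l ⟨a.x - l * a.y, 2 * a.y⟩, isIsogeny_rmRatRep_of_isUnit hZ (isUnit_pellUnit a),
    natCard_ker_rmRatRep_eq_one_of_isUnit Z (isUnit_pellUnit a),
    not_polarised_rmRatRep_of_isUnit hΔ0 hΔ (isUnit_pellUnit a) (pellUnit_ne_one hy) (pellUnit_ne_neg_one hy)⟩

end PellUnits

end SiegelModuli

end Literature.AlgebraicGeometry.ModuliOfAbelianVarieties

end
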